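import Summits.QuantumFields.YangMills.Theorems.BalabanUVNodesN09TransportPositiveOnDomainOfFibredChart
import Literature.MathematicalPhysics.QuantumFieldTheory.Balaban1983to89.BlockAveragingHaarAC
import HarnessLib

/-!
# BalabanUVNodes ∕ N09 — THE β-INPUT OF RECORD `ρ_k = χ^{(2.9)}_k·exp[−GF_k∕g_k² + A_k]` IS CONTINUOUS AT EVERY CONFIGURATION AT WHICH NO (2.9) THRESHOLD IS ACTIVE:
# the `hρc` binder of the local route (ROAD B) for threshold-cut densities, for the record's density, modulo the displayed continuity of the critical letters

Cell `pub-ymgap`, width seat `pub-ymgap-dag-n09-w2` generation 5 (HUMAN RULING D-0149; DAG node N09 = [Balaban1987RG1] §§2–5; INBOX CLAIM-1∕INTENT-1 l.37354).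
`--kind proof --supports stmt-QuantumFields-27364 --as helper` (K1⁹ `StabilityBRunRowsAtRecordR13SepCoPHV`; count-neutral; theorems only, 0 def ∕ 0 instance ∕ 0 notation ∕ 0 sorry).

WHY.  ROAD B to N09's analytic inclusion `hreg` for the record's SHARP cut-off closes BY NAME in dag-n09-w2 g4's `…N09ContTransportOfLoopSmallSharp.regular_of_loopSmall_sharp`
(p630065) — with dag-n09-w3 g5's (2.9) determinant family supplying `Γ`, `hΓan`, `hnf` (p629361 + `…N09Chi29ThresholdsNowhereFibreFlat`) and their announced junction
(CLAIM-6) supplying `hQ` — MODULO the displayed continuity clause `hρc : ∀ U ∈ K₀, Q U → ContinuousAt ρ U` with the exemption `Q U :=` «no (2.9) threshold is active at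
`U`», i.e. `fluctDev_k(U)(b) ≠ ε₁` at every non-distinguished bond.  For the record's β-input `ρ_k = betaInputOfRecord T (chiFixed29 ν ε₁) K g k =
χ^{(2.9)}_k · exp[−GF_k∕g_k² + A_k]` ([I] (0.19) p. 255 with the (2.9) cut-off p. 266) this clause is ELEMENTARY TOPOLOGY once three things are continuous at `U`:
the critical letters `V ↦ V^{(k)}(V̄)(b)` (N07 ∕ [B11] Thm 1 continuity of the minimiser along the averaging — dag-n09-w1's selector programme; DISPLAYED as `hcrit`),
the gauge-fixing density `GF_k` and the effective action `A_k` (the regularity tower's previous step; DISPLAYED).  Then every deviation `fluctDev_k(·)(b)` is continuous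
at `U`, each strict threshold `< ε₁` is LOCALLY CONSTANT at a configuration where it is not attained, the finitely many bonds combine, `χ^{(2.9)}_k` is locally constant
at `U`, and the (0.19) body is a product of functions continuous at `U`.  This file types exactly that, in NODE 00's vocabulary, and re-keys it at the Stage-13 record.

CONTENTS (theorems only; nothing of NODE 00 ∕ w1 ∕ w3 ∕ w4 restated).
§1 `isB0_iff_exists_centralBond` (`Iff.rfl`: lit-balaban's distinguished bond `B12SmallFieldDomain259.b0 c` IS pub-balaban's `centralBond c`), `not_isB0_iff` — the bridge between
   K0e's `IsB0` (the record's `χ^{(2.9)}`) and dag-n09-w3 g5's index set `{b // ∀ c, centralBond c ≠ b}` of the determinant family.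
§2 ★ `continuousAt_fluctDevOfRecord_of_continuousAt_crit` (+ `…_of_continuousAt_critCfg_avg`), `eventually_fluctDevOfRecord_lt_iff`, `eventually_forall_fluctDevOfRecord_lt_iff`,
   ★★ `chiFix29OfRecord_eventuallyEq_of_forall_ne`, ★★ `continuousAt_chiFix29OfRecord_of_forall_ne`, the all-bonds twins `chiFix29AllOfRecord_eventuallyEq_of_forall_ne` ∕
   `continuousAt_chiFix29AllOfRecord_of_forall_ne`.
§3 `continuousAt_integrand_of_eventuallyEq` (generic (0.19) body), ★★★ `continuousAt_betaInput_chi29_of_forall_ne`, ★★ `hρc_betaInput_chi29_of_hcrit` (the binder VERBATIM on a set `K₀`),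
   ★★ `hρc_betaInput_chi29_of_hcrit_of_continuousOn` (`GF_k`, `A_k` continuous on an OPEN `D ⊇ K₀` — the tower's currency `D := domAlt_k`), `hρc_betaInput_chi29_of_hcrit_centralBond`
   (dag-n09-w3's index shape).
§4 at the Stage-13 record (`TβOfRecord₁₃ = TcanOfRecord`, `chiβOfRecord₁₃ θ = chiFixed29 θ.ν θ.ε₂₉`, history `gOfRecord₁₃ θ P`): ★★ `continuousAt_betaInputOfRecord₁₃_of_forall_ne`,
   ★★ `hρc_betaInputOfRecord₁₃_of_hcrit_of_continuousOn_domAlt` (every `j < P.K`, `K₀ j ⊆ domAlt_j`).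

HONEST FRAMING.  LOCATED, count-neutral topology BY NAME over NODE 00's definitions (`Node00.SmallFieldChi29OfRecord`, `…TransportPositiveOnDomainOfFibredChart` §3's `rfl`
unfolding); `hcrit`, the continuity of `GF_k` ∕ `A_k`, the support sets `K₀` are DISPLAYED, never asserted; NOTHING of Bałaban's asserted; no estimate; `hreg`∕`contTOn` NOT
discharged; N09 NOT discharged; conjunct 1 (Lemma 4) ∕ FLAG №7 untouched; K0⁷ ∕ K1⁹ ∕ K2⁹ ∕ K3⁸ NOT closed; counts unmoved (typed 28∕28 · discharged 5∕28); no summit statement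
is proved here; R4 = the conditional finite-𝕋⁴ rung `BalabanLadder.UV` only — NOT continuum ∕ ℝ⁴ ∕ OS; the Yang–Mills mass gap (Clay) is NOT proved by any of this.
-/

noncomputable section

open Filter Topology Set Function MeasureTheory

namespace Summit.QuantumFields.YangMills.BalabanUVNodes.N09BetaInputContinuousOffChi29Thresholds

open Literature.MathematicalPhysics.QuantumFieldTheory.Balaban1983to89
open Literature.MathematicalPhysics.QuantumFieldTheory.Balaban1983to89.Node00
open Literature.MathematicalPhysics.QuantumFieldTheory.Balaban1983to89.T4Continuum (T4Family)
open Literature.MathematicalPhysics.QuantumFieldTheory.Balaban1983to89.BlockAveragingHaarAC (centralBond)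
open Literature.MathematicalPhysics.QuantumFieldTheory.Balaban1983to89.B12Eq019ActionBody (integrand)
open Literature.MathematicalPhysics.QuantumFieldTheory.Balaban1983to89.B12ContinuousTransportInvarianceOn (isOpen_domAltOfRecord continuous_dist1_SU)
open Summit.QuantumFields.YangMills.BalabanUVNodes.N09TransportPositiveOnDomainOfFibredChart (betaInput_chi29_apply)

variable {F : T4Family} {N : ℕ} [NeZero N]

/-! ## §1  The distinguished bonds of (2.9) ARE the central bonds of the (0.4) averaging -/

section Bonds

variable {K k : ℕ}

/-- **lit-balaban's distinguished bond `b₀(c)` of [I] p. 267 IS pub-balaban's central bond `β(c)`** (both are `line c ((L−1)∕2)`; `Iff.rfl`): K0e's `IsB0 b` reads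
`∃ c, centralBond c = b`. [cite: Balaban1987RG1, (2.9) p.266 and p.267 (bookkeeping)] -/
theorem isB0_iff_exists_centralBond (b : PBond (F.P K) k) : IsB0 (F := F) b ↔ ∃ c : PBond (F.P K) (k + 1), centralBond c = b := Iff.rfl

/-- The non-distinguished bonds of (2.9) are exactly dag-n09-w3 g5's index set `{b | ∀ c, centralBond c ≠ b}` of the determinant family.
[cite: Balaban1987RG1, (2.9) p.266 and p.267 (bookkeeping)] -/
theorem not_isB0_iff (b : PBond (F.P K) k) : ¬ IsB0 (F := F) b ↔ ∀ c : PBond (F.P K) (k + 1), centralBond c ≠ b := by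
  rw [isB0_iff_exists_centralBond, not_exists]

end Bonds

/-! ## §2  Off the thresholds `χ^{(2.9)}_k` is locally constant, given continuity of the critical letters -/

section Chi

variable (ν : Stage7Numerics) {K k : ℕ}

/-- ★ **THE (2.9) DEVIATION AT A BOND IS CONTINUOUS AT `U` as soon as the critical letter `V ↦ V^{(k)}(V̄)(b)` is** (`dist1`, inversion and multiplication are continuous on
`SU(N)`).  The hypothesis is N07's continuity of the minimiser along the averaging (dag-n09-w1's selector programme), DISPLAYED. [cite: Balaban1987RG1, (2.3) p.265 and (2.9) p.266] -/
theorem continuousAt_fluctDevOfRecord_of_continuousAt_crit {U : GaugeField (F.P K) k (SU N)} (b : PBond (F.P K) k)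
    (hcrit : ContinuousAt (fun V : GaugeField (F.P K) k (SU N) => critCfgOfRecord F N ν K k ((avOfRecord F N K k).avg V) b) U) :
    ContinuousAt (fun V : GaugeField (F.P K) k (SU N) => fluctDevOfRecord F N ν K k V b) U := by
  have e : (fun V : GaugeField (F.P K) k (SU N) => fluctDevOfRecord F N ν K k V b) =
      fun V => dist1 ((critCfgOfRecord F N ν K k ((avOfRecord F N K k).avg V) b)⁻¹ * V b) :=
    funext fun V => fluctDevOfRecord_apply ν K k V b
  rw [e]
  exact continuous_dist1_SU.continuousAt.comp (hcrit.inv.mul (continuous_apply b).continuousAt)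

/-- The same from continuity of the averaging at `U` and of `W ↦ V^{(k)}(W)(b)` at `Ū`. [cite: Balaban1987RG1, (2.3) p.265 and (2.9) p.266] -/
theorem continuousAt_fluctDevOfRecord_of_continuousAt_critCfg_avg {U : GaugeField (F.P K) k (SU N)} (b : PBond (F.P K) k)
    (havg : ContinuousAt (avOfRecord F N K k).avg U)
    (hcritW : ContinuousAt (fun W : GaugeField (F.P K) (k + 1) (SU N) => critCfgOfRecord F N ν K k W b) ((avOfRecord F N K k).avg U)) :
    ContinuousAt (fun V : GaugeField (F.P K) k (SU N) => fluctDevOfRecord F N ν K k V b) U :=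
  continuousAt_fluctDevOfRecord_of_continuousAt_crit ν b (ContinuousAt.comp (g := fun W => critCfgOfRecord F N ν K k W b) hcritW havg)

/-- **A STRICT THRESHOLD NOT ATTAINED AT `U` IS LOCALLY CONSTANT AT `U`**: if `fluctDev_k(·)(b)` is continuous at `U` and `fluctDev_k(U)(b) ≠ ε₁`, then near `U` the condition
`fluctDev_k(V)(b) < ε₁` holds iff it holds at `U`. [cite: Balaban1987RG1, (2.9) p.266] -/
theorem eventually_fluctDevOfRecord_lt_iff {ε₁ : ℝ} {U : GaugeField (F.P K) k (SU N)} (b : PBond (F.P K) k)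
    (hcont : ContinuousAt (fun V : GaugeField (F.P K) k (SU N) => fluctDevOfRecord F N ν K k V b) U)
    (hne : fluctDevOfRecord F N ν K k U b ≠ ε₁) :
    ∀ᶠ V in 𝓝 U, (fluctDevOfRecord F N ν K k V b < ε₁ ↔ fluctDevOfRecord F N ν K k U b < ε₁) := by
  rcases lt_or_gt_of_ne hne with hlt | hgt
  · filter_upwards [hcont.eventually_mem (Iio_mem_nhds hlt)] with V hV
    exact ⟨fun _ => hlt, fun _ => hV⟩
  · filter_upwards [hcont.eventually_mem (Ioi_mem_nhds hgt)] with V hV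
    exact ⟨fun h => absurd h (not_lt.2 (le_of_lt (α := ℝ) hV)), fun h => absurd h (not_lt.2 hgt.le)⟩

/-- … hence the CONJUNCTION over the non-distinguished bonds is locally constant at `U` (finitely many bonds). [cite: Balaban1987RG1, (2.9) p.266] -/
theorem eventually_forall_fluctDevOfRecord_lt_iff {ε₁ : ℝ} {U : GaugeField (F.P K) k (SU N)}
    (hcont : ∀ b : PBond (F.P K) k, ¬ IsB0 b → ContinuousAt (fun V : GaugeField (F.P K) k (SU N) => fluctDevOfRecord F N ν K k V b) U)
    (hne : ∀ b : PBond (F.P K) k, ¬ IsB0 b → fluctDevOfRecord F N ν K k U b ≠ ε₁) :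
    ∀ᶠ V in 𝓝 U, ((∀ b : PBond (F.P K) k, ¬ IsB0 b → fluctDevOfRecord F N ν K k V b < ε₁) ↔
      (∀ b : PBond (F.P K) k, ¬ IsB0 b → fluctDevOfRecord F N ν K k U b < ε₁)) := by
  have hall : ∀ᶠ V in 𝓝 U, ∀ b : PBond (F.P K) k, ¬ IsB0 b →
      (fluctDevOfRecord F N ν K k V b < ε₁ ↔ fluctDevOfRecord F N ν K k U b < ε₁) := by
    refine eventually_all.2 fun b => ?_
    by_cases hb : IsB0 b
    · exact Eventually.of_forall fun V h => absurd hb h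
    · exact (eventually_fluctDevOfRecord_lt_iff ν b (hcont b hb) (hne b hb)).mono fun V hV _ => hV
  filter_upwards [hall] with V hV
  exact ⟨fun h b hb => (hV b hb).1 (h b hb), fun h b hb => (hV b hb).2 (h b hb)⟩

/-- ★★ **`χ^{(2.9)}_k` IS LOCALLY CONSTANT AT A CONFIGURATION WITH NO ACTIVE THRESHOLD**: with the deviations at the non-distinguished bonds continuous at `U` and none equal to
`ε₁` there, `χ^{(2.9)}_k(V) = χ^{(2.9)}_k(U)` for all `V` near `U`. [cite: Balaban1987RG1, (2.9) p.266] -/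
theorem chiFix29OfRecord_eventuallyEq_of_forall_ne {ε₁ : ℝ} {U : GaugeField (F.P K) k (SU N)}
    (hcont : ∀ b : PBond (F.P K) k, ¬ IsB0 b → ContinuousAt (fun V : GaugeField (F.P K) k (SU N) => fluctDevOfRecord F N ν K k V b) U)
    (hne : ∀ b : PBond (F.P K) k, ¬ IsB0 b → fluctDevOfRecord F N ν K k U b ≠ ε₁) :
    chiFix29OfRecord F N ν ε₁ K k =ᶠ[𝓝 U] fun _ => chiFix29OfRecord F N ν ε₁ K k U := by
  filter_upwards [eventually_forall_fluctDevOfRecord_lt_iff ν hcont hne] with V hV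
  unfold chiFix29OfRecord
  by_cases h : ∀ b : PBond (F.P K) k, ¬ IsB0 b → fluctDevOfRecord F N ν K k V b < ε₁
  · rw [if_pos h, if_pos (hV.1 h)]
  · rw [if_neg h, if_neg fun h' => h (hV.2 h')]

/-- ★★ **`χ^{(2.9)}_k` IS CONTINUOUS AT EVERY CONFIGURATION WITH NO ACTIVE THRESHOLD** (given continuity of the deviations there). [cite: Balaban1987RG1, (2.9) p.266] -/
theorem continuousAt_chiFix29OfRecord_of_forall_ne {ε₁ : ℝ} {U : GaugeField (F.P K) k (SU N)}
    (hcont : ∀ b : PBond (F.P K) k, ¬ IsB0 b → ContinuousAt (fun V : GaugeField (F.P K) k (SU N) => fluctDevOfRecord F N ν K k V b) U)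
    (hne : ∀ b : PBond (F.P K) k, ¬ IsB0 b → fluctDevOfRecord F N ν K k U b ≠ ε₁) :
    ContinuousAt (chiFix29OfRecord F N ν ε₁ K k) U :=
  (continuousAt_const (y := chiFix29OfRecord F N ν ε₁ K k U)).congr_of_eventuallyEq
    (chiFix29OfRecord_eventuallyEq_of_forall_ne ν hcont hne)

/-- The ALL-BONDS twin `χ^{(2.9),all}_k` is locally constant at `U` when the deviations at ALL bonds are continuous at `U` and none equals `ε₁`. [cite: Balaban1987RG1, (2.9) p.266] -/
theorem chiFix29AllOfRecord_eventuallyEq_of_forall_ne {ε₁ : ℝ} {U : GaugeField (F.P K) k (SU N)}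
    (hcont : ∀ b : PBond (F.P K) k, ContinuousAt (fun V : GaugeField (F.P K) k (SU N) => fluctDevOfRecord F N ν K k V b) U)
    (hne : ∀ b : PBond (F.P K) k, fluctDevOfRecord F N ν K k U b ≠ ε₁) :
    chiFix29AllOfRecord F N ν ε₁ K k =ᶠ[𝓝 U] fun _ => chiFix29AllOfRecord F N ν ε₁ K k U := by
  have hall : ∀ᶠ V in 𝓝 U, ∀ b : PBond (F.P K) k,
      (fluctDevOfRecord F N ν K k V b < ε₁ ↔ fluctDevOfRecord F N ν K k U b < ε₁) :=
    eventually_all.2 fun b => eventually_fluctDevOfRecord_lt_iff ν b (hcont b) (hne b)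
  filter_upwards [hall] with V hV
  unfold chiFix29AllOfRecord
  by_cases h : ∀ b : PBond (F.P K) k, fluctDevOfRecord F N ν K k V b < ε₁
  · rw [if_pos h, if_pos fun b => (hV b).1 (h b)]
  · rw [if_neg h, if_neg fun h' => h fun b => (hV b).2 (h' b)]

/-- The ALL-BONDS twin is continuous at every configuration with no active threshold. [cite: Balaban1987RG1, (2.9) p.266] -/
theorem continuousAt_chiFix29AllOfRecord_of_forall_ne {ε₁ : ℝ} {U : GaugeField (F.P K) k (SU N)}
    (hcont : ∀ b : PBond (F.P K) k, ContinuousAt (fun V : GaugeField (F.P K) k (SU N) => fluctDevOfRecord F N ν K k V b) U)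
    (hne : ∀ b : PBond (F.P K) k, fluctDevOfRecord F N ν K k U b ≠ ε₁) :
    ContinuousAt (chiFix29AllOfRecord F N ν ε₁ K k) U :=
  (continuousAt_const (y := chiFix29AllOfRecord F N ν ε₁ K k U)).congr_of_eventuallyEq
    (chiFix29AllOfRecord_eventuallyEq_of_forall_ne ν hcont hne)

end Chi

/-! ## §3  The (0.19) body: `ρ_k = χ^{(2.9)}_k · exp[−GF_k∕g_k² + A_k]` is continuous off the thresholds — the `hρc` binder of the local route -/

section Body

/-- **GENERIC (0.19) BODY**: if the cut-off `χ` is locally constant at `U` and `GF`, `A` are continuous at `U`, then `integrand χ GF g A = χ·exp[−GF∕g² + A]` is continuous at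
`U`. [cite: Balaban1987RG1, (0.19) p.255 (bookkeeping)] -/
theorem continuousAt_integrand_of_eventuallyEq {P : Params} {G : Type*} [GaugeGroup G] [TopologicalSpace G] {j : ℕ}
    {χ GF A : Density P j G} {gk : ℝ} {U : GaugeField P j G}
    (hχ : χ =ᶠ[𝓝 U] fun _ => χ U) (hGF : ContinuousAt GF U) (hA : ContinuousAt A U) :
    ContinuousAt (integrand χ GF gk A) U := by
  have hχc : ContinuousAt χ U := (continuousAt_const (y := χ U)).congr_of_eventuallyEq hχ
  have hexp : ContinuousAt (fun V => Real.exp (-(1 / gk ^ 2) * GF V + A V)) U :=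
    Real.continuous_exp.continuousAt.comp ((continuousAt_const.mul hGF).add hA)
  exact hχc.mul hexp

variable (ν : Stage7Numerics) (ε₁ : ℝ) (T : Transport F N) (K : ℕ) (g : ℕ → ℝ) (k : ℕ)

/-- ★★★ **THE β-INPUT OF RECORD IS CONTINUOUS AT EVERY CONFIGURATION WITH NO ACTIVE (2.9) THRESHOLD**, for every transport `T`, history `g`, numerics `ν`, threshold `ε₁`:
`ρ_k = betaInputOfRecord T (chiFixed29 ν ε₁) K g k` is continuous at `U` provided the deviations at the non-distinguished bonds are continuous at `U` (⇐ hcrit) and none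
equals `ε₁`, and `GF_k = gfOfRecord K k`, `A_k = effActionHT T (chiFixed29 ν ε₁) K g k` are continuous at `U`. [cite: Balaban1987RG1, (0.19) p.255 and (2.9) p.266] -/
theorem continuousAt_betaInput_chi29_of_forall_ne {U : GaugeField (F.P K) k (SU N)}
    (hcont : ∀ b : PBond (F.P K) k, ¬ IsB0 b → ContinuousAt (fun V : GaugeField (F.P K) k (SU N) => fluctDevOfRecord F N ν K k V b) U)
    (hne : ∀ b : PBond (F.P K) k, ¬ IsB0 b → fluctDevOfRecord F N ν K k U b ≠ ε₁)
    (hGF : ContinuousAt (gfOfRecord F N K k) U) (hA : ContinuousAt (effActionHT F N T (chiFixed29 F N ν ε₁) K g k) U) :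
    ContinuousAt (betaInputOfRecord F N T (chiFixed29 F N ν ε₁) K g k) U := by
  have e : betaInputOfRecord F N T (chiFixed29 F N ν ε₁) K g k =
      integrand (chiFix29OfRecord F N ν ε₁ K k) (gfOfRecord F N K k) (g k) (effActionHT F N T (chiFixed29 F N ν ε₁) K g k) := rfl
  rw [e]
  exact continuousAt_integrand_of_eventuallyEq (chiFix29OfRecord_eventuallyEq_of_forall_ne ν hcont hne) hGF hA

/-- ★★ **THE `hρc` BINDER OF THE LOCAL ROUTE, VERBATIM, FOR THE β-INPUT OF RECORD**: on any set `K₀` of configurations on which the critical letters `V ↦ V^{(k)}(V̄)(b)`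
(non-distinguished `b`) and `GF_k`, `A_k` are continuous at every point, `∀ U ∈ K₀, (∀ b, ¬ IsB0 b → fluctDev_k(U)(b) ≠ ε₁) → ContinuousAt ρ_k U` — the shape consumed by
dag-n09-w2's `regular_of_loopSmall_sharp` ∕ `regular_of_sharpEngineFaces` with the exemption `Q U := ∀ b, ¬ IsB0 b → fluctDev_k(U)(b) ≠ ε₁`.
[cite: Balaban1987RG1, (0.19) p.255, (2.9) p.266 and p.259] -/
theorem hρc_betaInput_chi29_of_hcrit {K₀ : Set (GaugeField (F.P K) k (SU N))}
    (hcrit : ∀ U ∈ K₀, ∀ b : PBond (F.P K) k, ¬ IsB0 b →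
      ContinuousAt (fun V : GaugeField (F.P K) k (SU N) => critCfgOfRecord F N ν K k ((avOfRecord F N K k).avg V) b) U)
    (hGF : ∀ U ∈ K₀, ContinuousAt (gfOfRecord F N K k) U) (hA : ∀ U ∈ K₀, ContinuousAt (effActionHT F N T (chiFixed29 F N ν ε₁) K g k) U) :
    ∀ U ∈ K₀, (∀ b : PBond (F.P K) k, ¬ IsB0 b → fluctDevOfRecord F N ν K k U b ≠ ε₁) →
      ContinuousAt (betaInputOfRecord F N T (chiFixed29 F N ν ε₁) K g k) U :=
  fun U hU hne => continuousAt_betaInput_chi29_of_forall_ne ν ε₁ T K g k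
    (fun b hb => continuousAt_fluctDevOfRecord_of_continuousAt_crit ν b (hcrit U hU b hb)) hne (hGF U hU) (hA U hU)

/-- ★★ **THE SAME IN THE TOWER'S CURRENCY**: `GF_k` and `A_k` continuous ON an OPEN set `D ⊇ K₀` (at the record `D := domAlt_k`, where the regularity tower delivers `A_k` and
the support of `ρ_k` lies by the threshold hierarchy), hcrit on `K₀`. [cite: Balaban1987RG1, (0.19) p.255, (2.9) p.266 and p.259] -/
theorem hρc_betaInput_chi29_of_hcrit_of_continuousOn {K₀ D : Set (GaugeField (F.P K) k (SU N))} (hD : IsOpen D) (hK₀D : K₀ ⊆ D)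
    (hcrit : ∀ U ∈ K₀, ∀ b : PBond (F.P K) k, ¬ IsB0 b →
      ContinuousAt (fun V : GaugeField (F.P K) k (SU N) => critCfgOfRecord F N ν K k ((avOfRecord F N K k).avg V) b) U)
    (hGF : ContinuousOn (gfOfRecord F N K k) D) (hA : ContinuousOn (effActionHT F N T (chiFixed29 F N ν ε₁) K g k) D) :
    ∀ U ∈ K₀, (∀ b : PBond (F.P K) k, ¬ IsB0 b → fluctDevOfRecord F N ν K k U b ≠ ε₁) →
      ContinuousAt (betaInputOfRecord F N T (chiFixed29 F N ν ε₁) K g k) U :=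
  hρc_betaInput_chi29_of_hcrit ν ε₁ T K g k hcrit (fun _ hU => hGF.continuousAt (hD.mem_nhds (hK₀D hU)))
    (fun _ hU => hA.continuousAt (hD.mem_nhds (hK₀D hU)))

/-- The binder in dag-n09-w3 g5's index shape (`∀ c, centralBond c ≠ b` in place of `¬ IsB0 b`, §1). [cite: Balaban1987RG1, (0.19) p.255, (2.9) p.266 and p.267] -/
theorem hρc_betaInput_chi29_of_hcrit_centralBond {K₀ : Set (GaugeField (F.P K) k (SU N))}
    (hcrit : ∀ U ∈ K₀, ∀ b : PBond (F.P K) k, (∀ c : PBond (F.P K) (k + 1), centralBond c ≠ b) →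
      ContinuousAt (fun V : GaugeField (F.P K) k (SU N) => critCfgOfRecord F N ν K k ((avOfRecord F N K k).avg V) b) U)
    (hGF : ∀ U ∈ K₀, ContinuousAt (gfOfRecord F N K k) U) (hA : ∀ U ∈ K₀, ContinuousAt (effActionHT F N T (chiFixed29 F N ν ε₁) K g k) U) :
    ∀ U ∈ K₀, (∀ b : PBond (F.P K) k, (∀ c : PBond (F.P K) (k + 1), centralBond c ≠ b) → fluctDevOfRecord F N ν K k U b ≠ ε₁) →
      ContinuousAt (betaInputOfRecord F N T (chiFixed29 F N ν ε₁) K g k) U :=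
  fun U hU hne => hρc_betaInput_chi29_of_hcrit ν ε₁ T K g k (fun U hU b hb => hcrit U hU b ((not_isB0_iff b).1 hb)) hGF hA U hU
    (fun b hb => hne b ((not_isB0_iff b).1 hb))

end Body

/-! ## §4  At the Stage-13 record -/

section Record

/-- ★★ **AT THE STAGE-13 RECORD** (`TβOfRecord₁₃ = TcanOfRecord`, `chiβOfRecord₁₃ θ = chiFixed29 θ.ν θ.ε₂₉`, history `gOfRecord₁₃ θ P`): the β-input
`ρ_j = betaInputOfRecord (TβOfRecord₁₃) (chiβOfRecord₁₃ θ) P.K (gOfRecord₁₃ θ P) j` is continuous at every configuration `U` at which the deviations at the non-distinguished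
bonds are continuous and none equals `θ.ε₂₉`, and `GF_j`, `A_j` are continuous. [cite: Balaban1987RG1, (0.19) p.255 and (2.9) p.266] -/
theorem continuousAt_betaInputOfRecord₁₃_of_forall_ne (θ : Stage13Params F N) (P : B12.RunParams) {j : ℕ} {U : GaugeField (F.P P.K) j (SU N)}
    (hcont : ∀ b : PBond (F.P P.K) j, ¬ IsB0 b → ContinuousAt (fun V : GaugeField (F.P P.K) j (SU N) => fluctDevOfRecord F N θ.ν P.K j V b) U)
    (hne : ∀ b : PBond (F.P P.K) j, ¬ IsB0 b → fluctDevOfRecord F N θ.ν P.K j U b ≠ θ.ε₂₉)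
    (hGF : ContinuousAt (gfOfRecord F N P.K j) U)
    (hA : ContinuousAt (effActionHT F N (TβOfRecord₁₃ F N) (chiβOfRecord₁₃ F N θ) P.K (gOfRecord₁₃ F N θ P) j) U) :
    ContinuousAt (betaInputOfRecord F N (TβOfRecord₁₃ F N) (chiβOfRecord₁₃ F N θ) P.K (gOfRecord₁₃ F N θ P) j) U :=
  continuousAt_betaInput_chi29_of_forall_ne θ.ν θ.ε₂₉ (TβOfRecord₁₃ F N) P.K (gOfRecord₁₃ F N θ P) j hcont hne hGF hA

/-- ★★ **THE `hρc` BINDERS OF ALL STEPS AT THE STAGE-13 RECORD, IN THE TOWER'S CURRENCY**: per step `j < P.K` a set `K₀ j ⊆ domAlt_j` (at the record: a closed subset of the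
loop α-guard carrying the support of `ρ_j`, inside `domAlt_j` by the threshold hierarchy), hcrit on `K₀ j` at the non-distinguished bonds, `GF_j` and `A_j` continuous on
`domAltOfRecord θ.ν P.K j` (open, `isOpen_domAltOfRecord`); then for every `j < P.K`:
`∀ U ∈ K₀ j, (∀ b, ¬ IsB0 b → fluctDev_j(U)(b) ≠ θ.ε₂₉) → ContinuousAt ρ_j U`. [cite: Balaban1987RG1, (0.19) p.255, (2.9) p.266 and p.259] -/
theorem hρc_betaInputOfRecord₁₃_of_hcrit_of_continuousOn_domAlt (θ : Stage13Params F N) (P : B12.RunParams)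
    (K₀ : ∀ j, Set (GaugeField (F.P P.K) j (SU N))) (hK₀dom : ∀ j < P.K, K₀ j ⊆ domAltOfRecord F N θ.ν P.K j)
    (hcrit : ∀ j < P.K, ∀ U ∈ K₀ j, ∀ b : PBond (F.P P.K) j, ¬ IsB0 b →
      ContinuousAt (fun V : GaugeField (F.P P.K) j (SU N) => critCfgOfRecord F N θ.ν P.K j ((avOfRecord F N P.K j).avg V) b) U)
    (hGF : ∀ j < P.K, ContinuousOn (gfOfRecord F N P.K j) (domAltOfRecord F N θ.ν P.K j))
    (hA : ∀ j < P.K, ContinuousOn (effActionHT F N (TβOfRecord₁₃ F N) (chiβOfRecord₁₃ F N θ) P.K (gOfRecord₁₃ F N θ P) j) (domAltOfRecord F N θ.ν P.K j)) :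
    ∀ j < P.K, ∀ U ∈ K₀ j, (∀ b : PBond (F.P P.K) j, ¬ IsB0 b → fluctDevOfRecord F N θ.ν P.K j U b ≠ θ.ε₂₉) →
      ContinuousAt (betaInputOfRecord F N (TβOfRecord₁₃ F N) (chiβOfRecord₁₃ F N θ) P.K (gOfRecord₁₃ F N θ P) j) U :=
  fun j hj => hρc_betaInput_chi29_of_hcrit_of_continuousOn θ.ν θ.ε₂₉ (TβOfRecord₁₃ F N) P.K (gOfRecord₁₃ F N θ P) j
    (isOpen_domAltOfRecord θ.ν P.K j) (hK₀dom j hj) (hcrit j hj) (hGF j hj) (hA j hj)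

end Record

end Summit.QuantumFields.YangMills.BalabanUVNodes.N09BetaInputContinuousOffChi29Thresholds

end
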